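import Summits.CriticalPhenomena.CardyFormulaZ2.Theorems.CardyComplexConeEdgePrecompactVertexRelationOnceTwice

/-!
# The vertex relation, per pair of configurations: the pair identity
(line `qkz-strip-boundary-arm` of crux `CardyComplexCone.EdgePrecompact`, stmt-CriticalPhenomena-11387;
fourth file of the stub `stub_vertexRelation`, the `q = 1` half-Cauchy–Riemann vertex relation)

With the orbit phase sums `OPS_ω(q) = ∑_{j < N, orb j = q} φ (turnCount j)` of the previous file
(`…VertexRelationOnceTwice.lean`), the per-configuration defect of the vertex relation at the interior
medial vertex `e = cTgt p` is
`Φ(ω) = OPS_ω(oX) − OPS_ω(oY) − i · (OPS_ω(p₂) − OPS_ω(p))`, where `p₂` is the partner of `p` (the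
other corner arriving at `e`) and `oX = (p.1, p.2+1)`, `oY = (p.1 + u, p.2+3)` are the two corners
leaving `e` (clockwise table `NW, NE, SE, SW` of the crux: `oX, p₂, oY, p` for a horizontal `e`, so
`Φ = 0` in expectation is the relation with `χ = +i`; for a vertical `e` the table is `p₂, oY, p, oX`
and `Φ = 0` is again the relation with `χ = +i`). This file proves the PAIR IDENTITY
`Φ(ω) + Φ(ω') = 0` (`vertexRelation_pairSum`, registered sub-goal) for two configurations whose
completions agree off `e` and differ at `e`, for every multiplicative `φ : ℤ → ℂ` satisfying the two
identities of `λ = e^{−iπ/6}`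
  `2λ − λ⁻¹ = i(λ² − 2)`, `λ − 2λ⁻¹ = i(λ⁻² − 2)`
(both follow from `λ − λ̄ = −i`, `λλ̄ = 1`), GIVEN the turning numbers `4 · turnSign` of the loops
through the partners (hypothesis; supplied for Jordan data by `spliceLoop_turning_eq`). Cases: neither
corner of `e` is a dart of the path of `ω` — then the same holds for `ω'` (`cornerOrbit_toggle_case0`)
and all eight sums vanish; exactly one is (`pairSum_case1`: the pair is once/twice,
`vertexRelation_onceTwice` + the two identities); both are (`pairSum_case2`: then `ω'` is the
once-configuration, with the earlier dart, and the excised stretch is the loop, of period `i₂ − i₁`);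
the corner `p₂` in the role of `p` gives `−Φ`.

References: S. Smirnov, Ann. of Math. 172 (2010), proof of Lemma 4.5; H. Duminil-Copin, S. Smirnov,
arXiv:1109.1549, §8, Prop. 8.6; H. Duminil-Copin, arXiv:1208.3787, Prop. 4.
-/

namespace Summit.CriticalPhenomena.CardyFormulaZ2.Cruxes.EdgePrecompact.QkzStripBoundaryArm

open MeasureTheory Filter Set Metric
open scoped Topology BigOperators Pointwise
open Literature.Probability.LatticeModels Literature.Probability.Percolation
open Literature.Probability.RandomPlanarGeometry (DobrushinDomain)
open Summit.CriticalPhenomena.CardyFormulaZ2.Theses.CardyComplexCone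

/-! ## The two ring identities -/

/-- Crossing pair (`e` closed in the once-configuration): `2λ − λ⁻¹ = i(λ² − 2)` times `φ C`. -/
theorem alg_pos (φ : ℤ → ℂ) (hφ : ∀ m n, φ (m + n) = φ m * φ n)
    (hI1 : 2 * φ 1 - φ (-1) = Complex.I * (φ 2 - 2)) {Sd SX SY Sd₂ : ℂ} {C : ℤ}
    (h1 : Sd = 2 * φ C) (h2 : SX = 2 * φ (C + 1)) (h3 : SY = φ (C - 1)) (h4 : Sd₂ = φ (C + 2 * 1)) :
    SX - SY - Complex.I * (Sd₂ - Sd) = 0 := by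
  rw [h1, h2, h3, h4, sub_eq_add_neg C 1, hφ, hφ, show C + 2 * 1 = C + 2 by ring, hφ]
  linear_combination φ C * hI1

/-- Following pair (`e` open in the once-configuration): `λ − 2λ⁻¹ = i(λ⁻² − 2)` times `φ C`. -/
theorem alg_neg (φ : ℤ → ℂ) (hφ : ∀ m n, φ (m + n) = φ m * φ n)
    (hI2 : φ 1 - 2 * φ (-1) = Complex.I * (φ (-2) - 2)) {Sd SX SY Sd₂ : ℂ} {C : ℤ}
    (h1 : Sd = 2 * φ C) (h2 : SY = 2 * φ (C + -1)) (h3 : SX = φ (C - -1)) (h4 : Sd₂ = φ (C + 2 * -1)) :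
    SX - SY - Complex.I * (Sd₂ - Sd) = 0 := by
  rw [h1, h2, h3, h4, show C - -1 = C + 1 by ring, show C + 2 * -1 = C + -2 by ring, hφ, hφ, hφ]
  linear_combination φ C * hI2

/-! ## Corner bookkeeping at the toggled edge -/

/-- The cross-successor of the partner is the follow-successor of the corner. -/
theorem partner_X (p : Site 2 × Fin 4) :
    ((cornerPartner p).1, (cornerPartner p).2 + 1) = (p.1 + cornerUnit (p.2 + 1), p.2 + 3) := by
  simp only [cornerPartner, fin4_add_two_add_one]

/-- The follow-successor of the partner is the cross-successor of the corner. -/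
theorem partner_Y (p : Site 2 × Fin 4) :
    ((cornerPartner p).1 + cornerUnit ((cornerPartner p).2 + 1), (cornerPartner p).2 + 3) = (p.1, p.2 + 1) := by
  have h := partner_partner p
  refine Prod.ext ?_ ?_
  · show (cornerPartner (cornerPartner p)).1 = p.1
    rw [h]
  · show p.2 + 2 + 3 = p.2 + 1
    exact fin4_add_two_add_three p.2

/-- Minimal periods exist. -/
theorem exists_min_period {β : BondConfig (Site 2)} {q : Site 2 × Fin 4}
    (h : ∃ P, 0 < P ∧ cornerOrbit β q P = q) :
    ∃ Q, 0 < Q ∧ cornerOrbit β q Q = q ∧ ∀ s, 0 < s → s < Q → cornerOrbit β q s ≠ q := by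
  classical
  exact ⟨Nat.find h, (Nat.find_spec h).1, (Nat.find_spec h).2, fun s hs hsQ hq => Nat.find_min h hsQ ⟨hs, hq⟩⟩

/-- Off the path: a corner leaving `e` other than the start corner is a dart only right after a dart
arriving at `e`. -/
theorem forall_ne_of_out {E : DiscreteDobrushin} {ω : BondConfig (Site 2)} {c₀ p q : Site 2 × Fin 4} {N : ℕ}
    (hq : cSrc q = cTgt p) (hc₀q : c₀ ≠ q) (hnp : ∀ j < N, cornerOrbit (E.bcBondConfig ω) c₀ j ≠ p)
    (hnp₂ : ∀ j < N, cornerOrbit (E.bcBondConfig ω) c₀ j ≠ cornerPartner p) :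
    ∀ j < N, cornerOrbit (E.bcBondConfig ω) c₀ j ≠ q := by
  intro j hj h
  rcases j with _ | j
  · exact hc₀q h
  · have h1 : cTgt (cornerOrbit (E.bcBondConfig ω) c₀ j) = cTgt p := by
      rw [← hq, ← h]; exact (cSrc_nextCorner _).symm
    rcases cTgt_eq_cTgt_iff.1 h1 with h1 | h1
    · exact hnp j (by omega) h1
    · exact hnp₂ j (by omega) h1

/-! ## From the once/twice sums to the pair identity -/

/-- The pair identity for a once/twice pair, the once-configuration FIRST (hypotheses of
`vertexRelation_onceTwice`). -/
theorem pairSum_of_core : ∀ (φ : ℤ → ℂ), (∀ m n, φ (m + n) = φ m * φ n) → 2 * φ 1 - φ (-1) = Complex.I * (φ 2 - 2) → φ 1 - 2 * φ (-1) = Complex.I * (φ (-2) - 2) → ∀ (E : DiscreteDobrushin), E.IsZdAdmissible → ∀ (ω₁ ω₂ : BondConfig (Site 2)) (c₀ d : Site 2 × Fin 4) (N₁ N₂ i₁ Q : ℕ), E.IsStartCorner c₀ → (∀ e', e' ≠ cTgt d → (e' ∈ E.bcBondConfig ω₂ ↔ e' ∈ E.bcBondConfig ω₁)) → ¬ (cTgt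 d ∈ E.bcBondConfig ω₂ ↔ cTgt d ∈ E.bcBondConfig ω₁) → (∀ j, E.IsInnerFace (faceAt d.1 j)) → (∀ j, E.IsInnerFace (faceAt (d.1 + cornerUnit (d.2 + 1)) j)) → ¬ E.IsInnerFace (cFace (cornerOrbit (E.bcBondConfig ω₁) c₀ N₁)) → (∀ k < N₁, E.IsInnerFace (cFace (cornerOrbit (E.bcBondConfig ω₁) c₀ k))) → ¬ E.IsInnerFace (cFace (cornerOrbit (E.bcBondConfig ω₂) c₀ N₂)) → (∀ k < N₂, E.IsInnerFace (cFace (cornerOrbit (E.bcBondConfig ω₂) c₀ k))) → cornerOrbit (E.bcBondConfig ω₁) c₀ i₁ = d → i₁ < N₁ → (∀ i < N₁, cornerOrbit (E.bcBondConfig ω₁) c₀ i ≠ cornerPartner d) → 0 < Q → cornerOrbit (E.bcBondConfig ω₁) (cornerPartner d) Q = cornerPartner d → (∀ s, 0 < s → s < Q → cornerOrbit (E.bcBondConfig ω₁) (cornerPartner d) s ≠ cornerPartner d) → ∑ m ∈ Finset.range Q, turnSign (E.bcBondConfig ω₁) (cornerOrbit (E.bcBondConfig ω₁) (cornerPartner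 d) m) = 4 * turnSign (E.bcBondConfig ω₁) d → ((∑ j ∈ (Finset.range N₁).filter (fun j => cornerOrbit (E.bcBondConfig ω₁) c₀ j = (d.1, d.2 + 1)), φ (turnCount (E.bcBondConfig ω₁) c₀ j)) + (∑ j ∈ (Finset.range N₂).filter (fun j => cornerOrbit (E.bcBondConfig ω₂) c₀ j = (d.1, d.2 + 1)), φ (turnCount (E.bcBondConfig ω₂) c₀ j))) - ((∑ j ∈ (Finset.range N₁).filter (fun j => cornerOrbit (E.bcBondConfig ω₁) c₀ j = (d.1 + cornerUnit (d.2 + 1), d.2 + 3)), φ (turnCount (E.bcBondConfig ω₁) c₀ j)) + (∑ j ∈ (Finset.range N₂).filter (fun j => cornerOrbit (E.bcBondConfig ω₂) c₀ j = (d.1 + cornerUnit (d.2 + 1), d.2 + 3)), φ (turnCount (E.bcBondConfig ω₂) c₀ j))) - Complex.I * (((∑ j ∈ (Finset.range N₁).filter (fun j => cornerOrbit (E.bcBondConfig ω₁) c₀ j = cornerPartner d), φ (turnCount (E.bcBondConfig ω₁) c₀ j)) + (∑ j ∈ (Finset.range N₂).filter (fun j => cornerOrbit (E.bcBondConfig ω₂)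 c₀ j = cornerPartner d), φ (turnCount (E.bcBondConfig ω₂) c₀ j))) - ((∑ j ∈ (Finset.range N₁).filter (fun j => cornerOrbit (E.bcBondConfig ω₁) c₀ j = d), φ (turnCount (E.bcBondConfig ω₁) c₀ j)) + (∑ j ∈ (Finset.range N₂).filter (fun j => cornerOrbit (E.bcBondConfig ω₂) c₀ j = d), φ (turnCount (E.bcBondConfig ω₂) c₀ j)))) = 0 := by
  intro φ hφ hI1 hI2 E hE ω₁ ω₂ c₀ d N₁ N₂ i₁ Q hc₀ hagree hdiff hx hy hN₁ hlt₁ hN₂ hlt₂ hi₁ hi₁N h₂ hQ0 hQ hQmin hT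
  obtain ⟨h1, h2, h3, h4⟩ := vertexRelation_onceTwice φ E hE ω₁ ω₂ c₀ d N₁ N₂ i₁ Q hc₀ hagree hdiff hx hy hN₁ hlt₁
    hN₂ hlt₂ hi₁ hi₁N h₂ hQ0 hQ hQmin hT
  by_cases hm : cTgt d ∈ E.bcBondConfig ω₁
  · have hm' : cTgt d ∉ E.bcBondConfig ω₂ := fun h => hdiff ⟨fun _ => hm, fun _ => h⟩
    rw [nextCorner_of_mem hm] at h2
    rw [nextCorner_of_not_mem hm'] at h3
    rw [turnSign_of_mem hm] at h2 h3 h4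
    exact alg_neg φ hφ hI2 h1 h2 h3 h4
  · have hm' : cTgt d ∈ E.bcBondConfig ω₂ := by
      by_contra h
      exact hdiff ⟨fun h' => absurd h' h, fun h' => absurd h' hm⟩
    rw [nextCorner_of_not_mem hm] at h2
    rw [nextCorner_of_mem hm'] at h3
    rw [turnSign_of_not_mem hm] at h2 h3 h4
    exact alg_pos φ hφ hI1 h1 h2 h3 h4

/-- **Case 1**: `d` is a dart of the path of `ω` and its partner is not. -/
theorem pairSum_case1 : ∀ (φ : ℤ → ℂ), (∀ m n, φ (m + n) = φ m * φ n) → 2 * φ 1 - φ (-1) = Complex.I * (φ 2 - 2) → φ 1 - 2 * φ (-1) = Complex.I * (φ (-2) - 2) → ∀ (E : DiscreteDobrushin), E.IsZdAdmissible → ∀ (ω ω' : BondConfig (Site 2)) (c₀ d : Site 2 × Fin 4) (N N' i₁ : ℕ), E.IsStartCorner c₀ → (∀ e', e' ≠ cTgt d → (e' ∈ E.bcBondConfig ω' ↔ e' ∈ E.bcBondConfig ω)) → ¬ (cTgt d ∈ E.bcBondConfig ω' ↔ cTgt d ∈ E.bcBondConfig ω) → (∀ j, E.IsInnerFace (faceAt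 d.1 j)) → (∀ j, E.IsInnerFace (faceAt (d.1 + cornerUnit (d.2 + 1)) j)) → ¬ E.IsInnerFace (cFace (cornerOrbit (E.bcBondConfig ω) c₀ N)) → (∀ k < N, E.IsInnerFace (cFace (cornerOrbit (E.bcBondConfig ω) c₀ k))) → ¬ E.IsInnerFace (cFace (cornerOrbit (E.bcBondConfig ω') c₀ N')) → (∀ k < N', E.IsInnerFace (cFace (cornerOrbit (E.bcBondConfig ω') c₀ k))) → cornerOrbit (E.bcBondConfig ω) c₀ i₁ = d → i₁ < N → (∀ i < N, cornerOrbit (E.bcBondConfig ω) c₀ i ≠ cornerPartner d) → (∀ (ω₁ : BondConfig (Site 2)) (N₁ i₁ Q : ℕ), ¬ E.IsInnerFace (cFace (cornerOrbit (E.bcBondConfig ω₁) c₀ N₁)) → (∀ k < N₁, E.IsInnerFace (cFace (cornerOrbit (E.bcBondConfig ω₁) c₀ k))) → cornerOrbit (E.bcBondConfig ω₁) c₀ i₁ = d → i₁ < N₁ → (∀ i < N₁, cornerOrbit (E.bcBondConfig ω₁) c₀ i ≠ cornerPartner d) → 0 < Q → cornerOrbit (E.bcBondConfig ω₁) (cornerPartner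 d) Q = cornerPartner d → (∀ s, 0 < s → s < Q → cornerOrbit (E.bcBondConfig ω₁) (cornerPartner d) s ≠ cornerPartner d) → ∑ m ∈ Finset.range Q, turnSign (E.bcBondConfig ω₁) (cornerOrbit (E.bcBondConfig ω₁) (cornerPartner d) m) = 4 * turnSign (E.bcBondConfig ω₁) d) → ((∑ j ∈ (Finset.range N).filter (fun j => cornerOrbit (E.bcBondConfig ω) c₀ j = (d.1, d.2 + 1)), φ (turnCount (E.bcBondConfig ω) c₀ j)) + (∑ j ∈ (Finset.range N').filter (fun j => cornerOrbit (E.bcBondConfig ω') c₀ j = (d.1, d.2 + 1)), φ (turnCount (E.bcBondConfig ω') c₀ j))) - ((∑ j ∈ (Finset.range N).filter (fun j => cornerOrbit (E.bcBondConfig ω) c₀ j = (d.1 + cornerUnit (d.2 + 1), d.2 + 3)), φ (turnCount (E.bcBondConfig ω) c₀ j)) + (∑ j ∈ (Finset.range N').filter (fun j => cornerOrbit (E.bcBondConfig ω') c₀ j = (d.1 + cornerUnit (d.2 + 1), d.2 + 3)), φ (turnCount (E.bcBondConfig ω') c₀ j))) - Complex.I * (((∑ j ∈ (Finset.range N).filter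 (fun j => cornerOrbit (E.bcBondConfig ω) c₀ j = cornerPartner d), φ (turnCount (E.bcBondConfig ω) c₀ j)) + (∑ j ∈ (Finset.range N').filter (fun j => cornerOrbit (E.bcBondConfig ω') c₀ j = cornerPartner d), φ (turnCount (E.bcBondConfig ω') c₀ j))) - ((∑ j ∈ (Finset.range N).filter (fun j => cornerOrbit (E.bcBondConfig ω) c₀ j = d), φ (turnCount (E.bcBondConfig ω) c₀ j)) + (∑ j ∈ (Finset.range N').filter (fun j => cornerOrbit (E.bcBondConfig ω') c₀ j = d), φ (turnCount (E.bcBondConfig ω') c₀ j)))) = 0 := by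
  intro φ hφ hI1 hI2 E hE ω ω' c₀ d N N' i₁ hc₀ hagree hdiff hx hy hN hlt hN' hlt' hi₁ hi₁N h₂ hH
  have hmesh : (cornerPartner d).1 ∈ meshDomain E.Ω E.δ :=
    fst_mem_meshDomain_of_isInnerFace (q := cornerPartner d) (hy _)
  obtain ⟨Q, hQ0, hQ, hQmin⟩ := exists_min_period (exists_cornerOrbit_period (ω := ω) hE hmesh)
  exact pairSum_of_core φ hφ hI1 hI2 E hE ω ω' c₀ d N N' i₁ Q hc₀ hagree hdiff hx hy hN hlt hN' hlt' hi₁ hi₁N h₂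
    hQ0 hQ hQmin (hH ω N i₁ Q hN hlt hi₁ hi₁N h₂ hQ0 hQ hQmin)

/-- **Case 2**: `d = orb i₁` and its partner `orb i₂` are both darts of the path of `ω`, `d` first.
Then `ω'` is the once-configuration (exit at `N − (i₂ − i₁)`), the loop through the partner under
`ω'` being the excised stretch `orb (i₁+1), …, orb i₂` (minimal period `i₂ − i₁`). -/
theorem pairSum_case2 : ∀ (φ : ℤ → ℂ), (∀ m n, φ (m + n) = φ m * φ n) → 2 * φ 1 - φ (-1) = Complex.I * (φ 2 - 2) → φ 1 - 2 * φ (-1) = Complex.I * (φ (-2) - 2) → ∀ (E : DiscreteDobrushin), E.IsZdAdmissible → ∀ (ω ω' : BondConfig (Site 2)) (c₀ d : Site 2 × Fin 4) (N N' i₁ i₂ : ℕ), E.IsStartCorner c₀ → (∀ e', e' ≠ cTgt d → (e' ∈ E.bcBondConfig ω' ↔ e' ∈ E.bcBondConfig ω)) → ¬ (cTgt d ∈ E.bcBondConfig ω' ↔ cTgt d ∈ E.bcBondConfig ω) → (∀ j, E.IsInnerFace (faceAt d.1 j)) → (∀ j, E.IsInnerFace (faceAt (d.1 + cornerUnit (d.2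 + 1)) j)) → ¬ E.IsInnerFace (cFace (cornerOrbit (E.bcBondConfig ω) c₀ N)) → (∀ k < N, E.IsInnerFace (cFace (cornerOrbit (E.bcBondConfig ω) c₀ k))) → ¬ E.IsInnerFace (cFace (cornerOrbit (E.bcBondConfig ω') c₀ N')) → (∀ k < N', E.IsInnerFace (cFace (cornerOrbit (E.bcBondConfig ω') c₀ k))) → cornerOrbit (E.bcBondConfig ω) c₀ i₁ = d → cornerOrbit (E.bcBondConfig ω) c₀ i₂ = cornerPartner d → i₁ < i₂ → i₂ < N → (∀ (ω₁ : BondConfig (Site 2)) (N₁ i₁ Q : ℕ), ¬ E.IsInnerFace (cFace (cornerOrbit (E.bcBondConfig ω₁) c₀ N₁)) → (∀ k < N₁, E.IsInnerFace (cFace (cornerOrbit (E.bcBondConfig ω₁) c₀ k))) → cornerOrbit (E.bcBondConfig ω₁) c₀ i₁ = d → i₁ < N₁ → (∀ i < N₁, cornerOrbit (E.bcBondConfig ω₁) c₀ i ≠ cornerPartner d) → 0 < Q → cornerOrbit (E.bcBondConfig ω₁) (cornerPartner d) Q = cornerPartner d → (∀ s, 0 < s → s < Q → cornerOrbit (E.bcBondConfig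 ω₁) (cornerPartner d) s ≠ cornerPartner d) → ∑ m ∈ Finset.range Q, turnSign (E.bcBondConfig ω₁) (cornerOrbit (E.bcBondConfig ω₁) (cornerPartner d) m) = 4 * turnSign (E.bcBondConfig ω₁) d) → ((∑ j ∈ (Finset.range N).filter (fun j => cornerOrbit (E.bcBondConfig ω) c₀ j = (d.1, d.2 + 1)), φ (turnCount (E.bcBondConfig ω) c₀ j)) + (∑ j ∈ (Finset.range N').filter (fun j => cornerOrbit (E.bcBondConfig ω') c₀ j = (d.1, d.2 + 1)), φ (turnCount (E.bcBondConfig ω') c₀ j))) - ((∑ j ∈ (Finset.range N).filter (fun j => cornerOrbit (E.bcBondConfig ω) c₀ j = (d.1 + cornerUnit (d.2 + 1), d.2 + 3)), φ (turnCount (E.bcBondConfig ω) c₀ j)) + (∑ j ∈ (Finset.range N').filter (fun j => cornerOrbit (E.bcBondConfig ω') c₀ j = (d.1 + cornerUnit (d.2 + 1), d.2 + 3)), φ (turnCount (E.bcBondConfig ω') c₀ j))) - Complex.I * (((∑ j ∈ (Finset.range N).filter (fun j => cornerOrbit (E.bcBondConfig ω) c₀ j = cornerPartner d), φ (turnCount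 (E.bcBondConfig ω) c₀ j)) + (∑ j ∈ (Finset.range N').filter (fun j => cornerOrbit (E.bcBondConfig ω') c₀ j = cornerPartner d), φ (turnCount (E.bcBondConfig ω') c₀ j))) - ((∑ j ∈ (Finset.range N).filter (fun j => cornerOrbit (E.bcBondConfig ω) c₀ j = d), φ (turnCount (E.bcBondConfig ω) c₀ j)) + (∑ j ∈ (Finset.range N').filter (fun j => cornerOrbit (E.bcBondConfig ω') c₀ j = d), φ (turnCount (E.bcBondConfig ω') c₀ j)))) = 0 := by
  intro φ hφ hI1 hI2 E hE ω ω' c₀ d N N' i₁ i₂ hc₀ hagree hdiff hx hy hN hlt hN' hlt' hi₁ hi₂ h12 hi₂N hH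
  have hstep : ∀ (β : BondConfig (Site 2)) (c : Site 2 × Fin 4) (i : ℕ),
      cornerOrbit β c (i + 1) = nextCorner β (cornerOrbit β c i) := fun _ _ _ => rfl
  have hinj : ∀ a b, a < N → b < N → cornerOrbit (E.bcBondConfig ω) c₀ a = cornerOrbit (E.bcBondConfig ω) c₀ b → a = b := by
    intro a b ha hb h
    by_contra hne
    rcases Nat.lt_or_gt_of_ne hne with hab | hab
    · exact cornerOrbit_ne hE hc₀ hab (fun k hk => hlt k (by omega)) h
    · exact cornerOrbit_ne hE hc₀ hab (fun k hk => hlt k (by omega)) h.symm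
  obtain ⟨hpre, hshift⟩ := cornerOrbit_toggle_case2 hE hc₀ hagree hdiff hlt hi₁ hi₂ h12 hi₂N
  obtain ⟨hN'', hlt''⟩ := exit_toggle_case2 hE hc₀ hagree hdiff hN hlt hi₁ hi₂ h12 hi₂N
  obtain rfl : N' = N - (i₂ - i₁) := exit_unique hN' hlt' hN'' hlt''
  -- the loop through the partner under `ω'`
  have hloop : ∀ j, j + 1 ≤ i₂ - i₁ →
      cornerOrbit (E.bcBondConfig ω') (cornerPartner d) (j + 1) = cornerOrbit (E.bcBondConfig ω) c₀ (i₁ + 1 + j) := by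
    intro j hj
    induction j with
    | zero =>
      rw [hstep _ _ 0, cornerOrbit_zero', nextCorner_toggle hagree hdiff, Equiv.swap_apply_right, add_zero, hstep, hi₁]
    | succ j ih =>
      rw [show i₁ + 1 + (j + 1) = i₁ + 1 + j + 1 by omega, hstep _ _ (j + 1), hstep _ c₀ (i₁ + 1 + j), ih (by omega),
        nextCorner_toggle_of_ne hagree hdiff]
      · intro h; have := hinj _ _ (by omega) (by omega) (h.trans hi₁.symm); omega
      · intro h; have := hinj _ _ (by omega) hi₂N (h.trans hi₂.symm); omega
  have hQ' : cornerOrbit (E.bcBondConfig ω') (cornerPartner d) (i₂ - i₁) = cornerPartner d := by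
    have := hloop (i₂ - i₁ - 1) (by omega)
    rwa [show i₂ - i₁ - 1 + 1 = i₂ - i₁ by omega, show i₁ + 1 + (i₂ - i₁ - 1) = i₂ by omega, hi₂] at this
  have hQmin' : ∀ s, 0 < s → s < i₂ - i₁ → cornerOrbit (E.bcBondConfig ω') (cornerPartner d) s ≠ cornerPartner d := by
    intro s hs hsQ h
    have := hloop (s - 1) (by omega)
    rw [show s - 1 + 1 = s by omega, h, ← hi₂] at this
    have := hinj _ _ hi₂N (by omega) this; omega
  have h₂' : ∀ i < N - (i₂ - i₁), cornerOrbit (E.bcBondConfig ω') c₀ i ≠ cornerPartner d := by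
    intro i hi h
    by_cases hii : i ≤ i₁
    · rw [hpre i hii, ← hi₂] at h
      have := hinj _ _ (by omega) hi₂N h; omega
    · have hs := hshift (i - i₁ - 1) (by omega)
      rw [show i₁ + 1 + (i - i₁ - 1) = i by omega] at hs
      rw [hs, ← hi₂] at h
      have := hinj _ _ (by omega) hi₂N h; omega
  have hi₁' : cornerOrbit (E.bcBondConfig ω') c₀ i₁ = d := (hpre i₁ le_rfl).trans hi₁
  have hi₁N' : i₁ < N - (i₂ - i₁) := by omega
  have hT := hH ω' (N - (i₂ - i₁)) i₁ (i₂ - i₁) hN'' hlt'' hi₁' hi₁N' h₂' (by omega) hQ' hQmin'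
  have key := pairSum_of_core φ hφ hI1 hI2 E hE ω' ω c₀ d (N - (i₂ - i₁)) N i₁ (i₂ - i₁) hc₀
    (fun e he => (hagree e he).symm) (fun h => hdiff h.symm) hx hy hN'' hlt'' hN hlt hi₁' hi₁N' h₂' (by omega) hQ'
    hQmin' hT
  linear_combination key

/-! ## The pair identity -/

/-- **The pair identity of the vertex relation** (registered sub-goal `vertexRelation_pairSum` of
stmt-CriticalPhenomena-11387). Admissible data, start corner `c₀`, an edge `e = cTgt p` with interior
endpoints; two configurations `ω`, `ω'` whose completions agree off `e` and differ at `e`, with exit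
times `N`, `N'`; `φ : ℤ → ℂ` multiplicative with the two identities of `e^{−iπ/6}`; and the turning
numbers `4 · turnSign` of the loops through the partners of the darts arriving at `e` (for every
configuration). Then `Φ(ω) + Φ(ω') = 0` for the defect
`Φ(ω) = OPS(oX) − OPS(oY) − i (OPS(p₂) − OPS(p))` of the vertex relation (`χ = +i`). -/
theorem vertexRelation_pairSum : ∀ (φ : ℤ → ℂ), (∀ m n, φ (m + n) = φ m * φ n) → 2 * φ 1 - φ (-1) = Complex.I * (φ 2 - 2) → φ 1 - 2 * φ (-1) = Complex.I * (φ (-2) - 2) → ∀ (E : DiscreteDobrushin), E.IsZdAdmissible → ∀ (ω ω' : BondConfig (Site 2)) (c₀ p : Site 2 × Fin 4) (N N' : ℕ), E.IsStartCorner c₀ → (∀ e', e' ≠ cTgt p → (e' ∈ E.bcBondConfig ω' ↔ e' ∈ E.bcBondConfig ω)) → ¬ (cTgt p ∈ E.bcBondConfig ω' ↔ cTgt p ∈ E.bcBondConfig ω) → (∀ j, E.IsInnerFace (faceAt p.1 j)) → (∀ j, E.IsInnerFace (faceAt (p.1 + cornerUnit (p.2 + 1)) j)) → ¬ E.IsInnerFace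 (cFace (cornerOrbit (E.bcBondConfig ω) c₀ N)) → (∀ k < N, E.IsInnerFace (cFace (cornerOrbit (E.bcBondConfig ω) c₀ k))) → ¬ E.IsInnerFace (cFace (cornerOrbit (E.bcBondConfig ω') c₀ N')) → (∀ k < N', E.IsInnerFace (cFace (cornerOrbit (E.bcBondConfig ω') c₀ k))) → (∀ (ω₁ : BondConfig (Site 2)) (p₁ : Site 2 × Fin 4) (N₁ i₁ Q : ℕ), cTgt p₁ = cTgt p → ¬ E.IsInnerFace (cFace (cornerOrbit (E.bcBondConfig ω₁) c₀ N₁)) → (∀ k < N₁, E.IsInnerFace (cFace (cornerOrbit (E.bcBondConfig ω₁) c₀ k))) → cornerOrbit (E.bcBondConfig ω₁) c₀ i₁ = p₁ → i₁ < N₁ → (∀ i < N₁, cornerOrbit (E.bcBondConfig ω₁) c₀ i ≠ cornerPartner p₁) → (∀ j, E.IsInnerFace (faceAt (p₁.1 + cornerUnit (p₁.2 + 1)) j)) → 0 < Q → cornerOrbit (E.bcBondConfig ω₁) (cornerPartner p₁) Q = cornerPartner p₁ → (∀ s, 0 < s → s < Q → cornerOrbit (E.bcBondConfig ω₁) (cornerPartner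 p₁) s ≠ cornerPartner p₁) → ∑ m ∈ Finset.range Q, turnSign (E.bcBondConfig ω₁) (cornerOrbit (E.bcBondConfig ω₁) (cornerPartner p₁) m) = 4 * turnSign (E.bcBondConfig ω₁) p₁) → ((∑ j ∈ (Finset.range N).filter (fun j => cornerOrbit (E.bcBondConfig ω) c₀ j = (p.1, p.2 + 1)), φ (turnCount (E.bcBondConfig ω) c₀ j)) - (∑ j ∈ (Finset.range N).filter (fun j => cornerOrbit (E.bcBondConfig ω) c₀ j = (p.1 + cornerUnit (p.2 + 1), p.2 + 3)), φ (turnCount (E.bcBondConfig ω) c₀ j)) - Complex.I * ((∑ j ∈ (Finset.range N).filter (fun j => cornerOrbit (E.bcBondConfig ω) c₀ j = cornerPartner p), φ (turnCount (E.bcBondConfig ω) c₀ j)) - (∑ j ∈ (Finset.range N).filter (fun j => cornerOrbit (E.bcBondConfig ω) c₀ j = p), φ (turnCount (E.bcBondConfig ω) c₀ j)))) + ((∑ j ∈ (Finset.range N').filter (fun j => cornerOrbit (E.bcBondConfig ω') c₀ j = (p.1, p.2 + 1)), φ (turnCount (E.bcBondConfig ω') c₀ j)) - (∑ j ∈ (Finset.range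 N').filter (fun j => cornerOrbit (E.bcBondConfig ω') c₀ j = (p.1 + cornerUnit (p.2 + 1), p.2 + 3)), φ (turnCount (E.bcBondConfig ω') c₀ j)) - Complex.I * ((∑ j ∈ (Finset.range N').filter (fun j => cornerOrbit (E.bcBondConfig ω') c₀ j = cornerPartner p), φ (turnCount (E.bcBondConfig ω') c₀ j)) - (∑ j ∈ (Finset.range N').filter (fun j => cornerOrbit (E.bcBondConfig ω') c₀ j = p), φ (turnCount (E.bcBondConfig ω') c₀ j)))) = 0 := by
  intro φ hφ hI1 hI2 E hE ω ω' c₀ p N N' hc₀ hagree hdiff hx hy hN hlt hN' hlt' hH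
  classical
  -- the partner and the two outgoing corners
  have hp₂x : (cornerPartner p).1 + cornerUnit ((cornerPartner p).2 + 1) = p.1 := congrArg Prod.fst (partner_Y p)
  have hy' : ∀ j, E.IsInnerFace (faceAt ((cornerPartner p).1 + cornerUnit ((cornerPartner p).2 + 1)) j) := by
    rw [hp₂x]; exact hx
  have hHp : (∀ (ω₁ : BondConfig (Site 2)) (N₁ i₁ Q : ℕ), ¬ E.IsInnerFace (cFace (cornerOrbit (E.bcBondConfig ω₁) c₀ N₁)) → (∀ k < N₁, E.IsInnerFace (cFace (cornerOrbit (E.bcBondConfig ω₁) c₀ k))) → cornerOrbit (E.bcBondConfig ω₁) c₀ i₁ = p → i₁ < N₁ → (∀ i < N₁, cornerOrbit (E.bcBondConfig ω₁) c₀ i ≠ cornerPartner p) → 0 < Q → cornerOrbit (E.bcBondConfig ω₁) (cornerPartner p) Q = cornerPartner p → (∀ s, 0 < s → s < Q → cornerOrbit (E.bcBondConfig ω₁) (cornerPartner p) s ≠ cornerPartner p) → ∑ m ∈ Finset.range Q, turnSign (E.bcBondConfig ω₁) (cornerOrbit (E.bcBondConfig ω₁) (cornerPartner p) m) = 4 *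 turnSign (E.bcBondConfig ω₁) p) := fun ω₁ N₁ i₁ Q a b c d' e f g h => hH ω₁ p N₁ i₁ Q rfl a b c d' e hy f g h
  have hHp₂ : (∀ (ω₁ : BondConfig (Site 2)) (N₁ i₁ Q : ℕ), ¬ E.IsInnerFace (cFace (cornerOrbit (E.bcBondConfig ω₁) c₀ N₁)) → (∀ k < N₁, E.IsInnerFace (cFace (cornerOrbit (E.bcBondConfig ω₁) c₀ k))) → cornerOrbit (E.bcBondConfig ω₁) c₀ i₁ = (cornerPartner p) → i₁ < N₁ → (∀ i < N₁, cornerOrbit (E.bcBondConfig ω₁) c₀ i ≠ cornerPartner (cornerPartner p)) → 0 < Q → cornerOrbit (E.bcBondConfig ω₁) (cornerPartner (cornerPartner p)) Q = cornerPartner (cornerPartner p) → (∀ s, 0 < s → s < Q → cornerOrbit (E.bcBondConfig ω₁) (cornerPartner (cornerPartner p)) s ≠ cornerPartner (cornerPartner p)) → ∑ m ∈ Finset.range Q, turnSign (E.bcBondConfig ω₁) (cornerOrbit (E.bcBondConfig ω₁) (cornerPartner (cornerPartner p)) m) = 4 * turnSign (E.bcBondConfig ω₁) (cornerPartner p)) :=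 fun ω₁ N₁ i₁ Q a b c d' e f g h =>
    hH ω₁ (cornerPartner p) N₁ i₁ Q (cTgt_partner p) a b c d' e hy' f g h
  have hagree₂ : ∀ e', e' ≠ cTgt (cornerPartner p) → (e' ∈ E.bcBondConfig ω' ↔ e' ∈ E.bcBondConfig ω) := by
    rw [cTgt_partner]; exact hagree
  have hdiff₂ : ¬ (cTgt (cornerPartner p) ∈ E.bcBondConfig ω' ↔ cTgt (cornerPartner p) ∈ E.bcBondConfig ω) := by
    rw [cTgt_partner]; exact hdiff
  by_cases hp : ∃ i₁ < N, cornerOrbit (E.bcBondConfig ω) c₀ i₁ = p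
  · obtain ⟨i₁, hi₁N, hi₁⟩ := hp
    by_cases hp₂ : ∃ i₂ < N, cornerOrbit (E.bcBondConfig ω) c₀ i₂ = cornerPartner p
    · obtain ⟨i₂, hi₂N, hi₂⟩ := hp₂
      have hne : i₁ ≠ i₂ := by
        rintro rfl
        exact partner_ne p (hi₂.symm.trans hi₁)
      rcases Nat.lt_or_gt_of_ne hne with h12 | h21
      · have key := pairSum_case2 φ hφ hI1 hI2 E hE ω ω' c₀ p N N' i₁ i₂ hc₀ hagree hdiff hx hy hN hlt hN' hlt' hi₁
          hi₂ h12 hi₂N hHp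
        linear_combination key
      · have key := pairSum_case2 φ hφ hI1 hI2 E hE ω ω' c₀ (cornerPartner p) N N' i₂ i₁ hc₀ hagree₂ hdiff₂ hy hy'
          hN hlt hN' hlt' hi₂ (by rw [partner_partner]; exact hi₁) h21 hi₁N hHp₂
        rw [partner_X, partner_Y, partner_partner] at key
        linear_combination -key
    · push Not at hp₂
      have key := pairSum_case1 φ hφ hI1 hI2 E hE ω ω' c₀ p N N' i₁ hc₀ hagree hdiff hx hy hN hlt hN' hlt' hi₁ hi₁N
        hp₂ hHp
      linear_combination key
  · push Not at hp
    by_cases hp₂ : ∃ i₂ < N, cornerOrbit (E.bcBondConfig ω) c₀ i₂ = cornerPartner p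
    · obtain ⟨i₂, hi₂N, hi₂⟩ := hp₂
      have key := pairSum_case1 φ hφ hI1 hI2 E hE ω ω' c₀ (cornerPartner p) N N' i₂ hc₀ hagree₂ hdiff₂ hy hy' hN hlt
        hN' hlt' hi₂ hi₂N (by rw [partner_partner]; exact hp) hHp₂
      rw [partner_X, partner_Y, partner_partner] at key
      linear_combination -key
    · push Not at hp₂
      -- neither corner of `e` is a dart: the two paths coincide and all eight sums vanish
      have h0 := cornerOrbit_toggle_case0 hagree hdiff (N := N) hp hp₂
      obtain rfl : N' = N := exit_unique hN' hlt' (by rw [h0 N le_rfl]; exact hN)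
        (fun k hk => by rw [h0 k hk.le]; exact hlt k hk)
      have hp' : ∀ j < N', cornerOrbit (E.bcBondConfig ω') c₀ j ≠ p := fun j hj => by
        rw [h0 j hj.le]; exact hp j hj
      have hp₂' : ∀ j < N', cornerOrbit (E.bcBondConfig ω') c₀ j ≠ cornerPartner p := fun j hj => by
        rw [h0 j hj.le]; exact hp₂ j hj
      have hyBd : (cornerPartner p).1 ∉ E.zdBoundary := by
        rintro (⟨-, w, hvw, hnot⟩ | ⟨w, -, -, g, hg, hvg, -⟩)
        · obtain ⟨k, rfl⟩ := exists_eq_add_cornerUnit hvw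
          exact hnot (DiscreteDobrushin.adj_of_isInnerFace_faceAt (hy k) (Or.inl rfl))
        · obtain ⟨k, rfl⟩ := exists_faceAt_of_isCorner hvg
          exact hg (hy k)
      have hc₀X : c₀ ≠ (p.1, p.2 + 1) := fun h =>
        hyBd (E.zdArcB_subset_zdBoundary (by have := hc₀.mem_zdArcB; rw [h] at this; exact this))
      have hc₀Y : c₀ ≠ (p.1 + cornerUnit (p.2 + 1), p.2 + 3) := fun h =>
        hyBd (E.zdArcA_subset_zdBoundary (by have := hc₀.mem_zdArcA; rw [h] at this; exact this))
      have hsX : cSrc (p.1, p.2 + 1) = cTgt p := rfl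
      have hsY : cSrc (p.1 + cornerUnit (p.2 + 1), p.2 + 3) = cTgt p := by
        rw [← nextCorner_of_mem (Set.mem_univ (cTgt p)), cSrc_nextCorner]
      have z : ∀ (ω₁ : BondConfig (Site 2)) (q : Site 2 × Fin 4), (∀ j < N', cornerOrbit (E.bcBondConfig ω₁) c₀ j ≠ q) →
          (∑ j ∈ (Finset.range N').filter (fun j => cornerOrbit (E.bcBondConfig ω₁) c₀ j = q),
            φ (turnCount (E.bcBondConfig ω₁) c₀ j)) = 0 :=
        fun ω₁ q h => sum_filter_eq_zero_of_forall_not _ _ _ fun j hj => h j (Finset.mem_range.1 hj)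
      rw [z ω _ (forall_ne_of_out hsX hc₀X hp hp₂), z ω _ (forall_ne_of_out hsY hc₀Y hp hp₂), z ω _ hp₂, z ω _ hp,
        z ω' _ (forall_ne_of_out hsX hc₀X hp' hp₂'), z ω' _ (forall_ne_of_out hsY hc₀Y hp' hp₂'), z ω' _ hp₂', z ω' _ hp']
      simp

end Summit.CriticalPhenomena.CardyFormulaZ2.Cruxes.EdgePrecompact.QkzStripBoundaryArm
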